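import Summits.QuantumFields.QCD.Theses.QuarksAsStableAction
import Summits.QuantumFields.QCD.Theses.FourMirrorsWardE1
import Literature.MathematicalPhysics.QuantumFieldTheory.DiagonalLatticeClustering
import Literature.MathematicalPhysics.QuantumFieldTheory.OSReconstructionNoE1
import HarnessLib.Audit

/-!
# Skeleton (BC3) for the piece `stub_thresholdQCD : ThresholdQCD` of crux `StableActionBridge`
# (stmt-QuantumFields-9737) — `Cruxes/StableActionBridge/Lines/stub_thresholdQCD.lean`

Route `route-QuantumFields-QuarksAsStableAction` (sub-problem QCD).  The deciding crux
`StableActionBridge := UnquenchedChessboardBound → WilsonQuarkStability → QCD` is, with A (#3) and S (#4)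
theorems of the tree, the conjunct `QCD` itself (`stableActionBridge_iff_qcd`, landed), and the route
carries it as a BRIDGE SPLIT joined by modus ponens / a least-threshold argument
(`Lines/Sketch.lean`: `ThresholdQCD ∧ (ThresholdQCD → QCDOf)`; `Lines/least_threshold.lean`:
`ThresholdQCD → MassContinuation → ChiralTupleGapless → StableActionBridge`).  In both decompositions the
BARE SIDE is the piece

* `stub_thresholdQCD : ThresholdQCD` — item stmt-QuantumFields-8794 (kind target of route
  HeavyThresholdYMBridge, crux rank 7 of QuarksAsStableAction; decl
  `Summit.QuantumFields.QCD.Theses.QuarksAsStableAction.ThresholdQCD`, definitionally the same `Prop` as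
  `…HeavyThresholdYMBridge.ThresholdQCD`): for `N_f ∈ {2,3}` a threshold `M₀ ≥ 0` and ONE mass-scaling
  regularisation `reg` such that every mass tuple above `M₀` carries OS data `T` with `IsQCDAlong`,
  non-trivial non-Gaussian glue, dynamical flavour-changing pseudoscalars and one `Δ > 0` for
  `T.HasMassGap Δ ∧ HasLatticeMassGap Δ` — HEAVY-QUARK (threshold) QCD, no chiral clause.

Human ruling 2026-08-16 21:1x CDT ("a plan for both sides"): every OPEN piece of a bridge split needs its
own registered skeleton.  This file is that skeleton for the bare side (registrar seat
`planner-skel-stmt-QuantumFields-9737-stub_thresholdQC-0`, 2026-08-17).  It is LINE-NEUTRAL and cut along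
the seam every existence route of this sub-problem already uses — HONEST LATTICE PACKAGE (UV + IR, with the
limit object) ⟹ OS CLOSURE MODULO ROTATIONS ⟹ ROTATIONS — transported to the heavy corner, so that two of
the four stubs are VERBATIM the closure stubs (S2), (S3) of the registered birth skeletons of the sibling
cruxes `FourMirrorsWardE1.QCDModuloRotations` (`Cruxes/QCDModuloRotations/Lines/birth.lean`,
stmt-QuantumFields-17271) and `GapBuysCauchyRate.ConvergentOSClosure` (`Cruxes/ConvergentOSClosure/Lines/birth.lean`,
stmt-QuantumFields-11525), the rotation stub is the shared E1 item `FourMirrorsWardE1.RotationRestoration`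
(stmt-QuantumFields-8840, its own registered skeleton `Cruxes/RotationRestoration/Lines/birth.lean`) BY
NAME, and one proof serves all of them:

* `stub_heavyLatticePackage : HeavyLatticePackageStmt` — **THE HARD STUB (open-problem): heavy-quark
  lattice QCD with its UV package, the lattice gap and the species witnesses.**  For `N_f ∈ {2,3}`:
  `M₀ ≥ 0` and a regularisation `reg` with `HasMassScaling` such that for every tuple `m` with all
  `m_f > M₀` there are `z, shift` and a labelled family `S` that is NORMALISED (E0), of LINEAR GROWTH
  (E0'), SYMMETRIC (E3), TRANSLATION INVARIANT on `⁰𝒮`, IS the `k → ∞` limit of the honest lattice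
  `n`-point functions `qcdLatticeSchwinger (reg.scheme m z shift) k` on off-diagonal real tensors
  (two-loop asymptotic scaling, bare Wilson masses eventually on the physical branch), with a uniform
  lattice gap `Δ > 0` at the same couplings, and whose `glue` two-point / three-point and flavour-changing
  `pseudoRe f g` two-point functions are connected-non-zero AT THE LEVEL OF `S`.  It is the sibling's
  (S1) `LatticePackageStmt` with the chiral clause `IsChiralAtZero` REMOVED and the positive orthant
  replaced by the half-orthant above a threshold — the statement into which this route's proved
  stability inputs A = `UnquenchedChessboardBound` (chessboard rarity of bad plaquettes,
  `UnquenchedChessboardBound_of`) and S = `WilsonQuarkStability` (`WilsonQuarkStability_of`) are to be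
  fed by the foreseen chain DiluteDislocations → SmallFieldQuarkRG → RobustYMInfrared of the route header,
  and which the sibling route HeavyThresholdYMBridge reaches as `RobustYangMillsRG` (17812) →
  `ConstructiveDecouplingRG` (14667; its registered skeleton's `stub_rgBridgeLattice` is a conditional,
  Cauchy–Schwarz-clustering form of this stub).  What it deliberately does NOT contain: E0-hermiticity,
  E2, E4, rotation-E1 and the continuum gap — the closure below.
* `stub_reflectionAxioms : ReflectionAxiomsStmt` — **IR-soft: E0-hermiticity, E2, E4 of a lattice limit**
  (open, size L; VERBATIM the siblings' (S2)).  For EVERY two-loop-AF lattice-QCD scheme with bare masses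
  eventually on the physical branch and a uniform lattice gap, every normalised, linear-growth,
  translation-invariant labelled family that is the limit of its `n`-point functions on off-diagonal
  real tensors is hermitian, reflection positive and clustering.  Content: the own-torus functional
  (time-PERIODIC Wilson fermions: a `(−1)^F`-twisted trace) compared with a reflection-positive one
  (Osterwalder–Seiler/Lüscher site-RP for `r = 1`, `m_f(k) > −1`) with an error vanishing as `k → ∞`
  (bought from the gap and `a_k L_k → ∞`); Θ-reality (γ₅-hermiticity); E4 along spatial directions
  from the hypercubic images of the lattice gap.
* `stub_speciesDiagClustering : SpeciesDiagClusteringStmt` — **IR-hard, lattice side: the gap in OS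
  currency** (open, size L/XL; VERBATIM the siblings' (S3)).  Along such a scheme `HasLatticeMassGap Δ`
  (pairs of FIXED gauge-invariant local observables, pair-dependent constants) plus convergence of the
  species `n`-point functions upgrades to diagonal clustering AT THE SAME RATE `Δ` of the smeared
  renormalised species fields on the scheme's own tori, `sch.HasSpeciesDiagClustering Δ` (tree
  `DiagonalLatticeClustering`).  Content: Lüscher's positive transfer matrix (Montvay–Münster (4.111)),
  spectral reading of the all-pairs gap, thermal wrap-around control.
* `stub_rotationRestoration : FourMirrorsWardE1.RotationRestoration` — **the E1 module BY NAME** (item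
  stmt-QuantumFields-8840, open-problem, shared crux of FourMirrorsWardE1 / DiagonalSpine /
  GapBuysCauchyRate, stub of the ConstructiveDecouplingRG and RotationRestoration skeletons): every
  full-sequence limit of honest lattice QCD `n`-point functions along a two-loop AF scheme on the
  physical branch with a uniform lattice gap is invariant under proper rotations on `⁰𝒮`.

`ThresholdQCD_of : Registered.stub_heavyLatticePackage → Registered.stub_reflectionAxioms →
Registered.stub_speciesDiagClustering → Registered.stub_rotationRestoration → ThresholdQCD` (hypotheses
keyed by the registered stub names, conclusion the QuarksAsStableAction route decl BY NAME) is
kernel-checked with NO `sorry`, and it is NOT modus ponens: per `N_f ∈ {2,3}` the package gives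
`M₀, reg` and, per tuple above `M₀`, `z, shift, S` with E0/E0'/E3/translations/limit/lattice gap `Δ`;
the IR-soft stub gives E0-hermiticity/E2/E4; the E1 module applied to THIS scheme and THIS limit gives
proper rotations; `OSAxiomsSchwinger S` is assembled field by field and `T := OSData.ofAxioms S _`
(`T.schwinger = S` by `rfl`), so `IsQCDAlong (reg.scheme m z shift) T` holds by its three clauses and
the species clauses hold definitionally from their `S`-level forms; the lattice gap `Δ` ⇒ species
diagonal clustering at `Δ` (IR-hard stub) ⇒ `T.HasMassGap Δ` by the LANDED transfer
`IsQCDAlong.hasMassGap_of_hasSpeciesDiagClustering` — the SAME `Δ` as the lattice gap, as the piece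
demands.  `ThresholdQCD_proof` instantiates it with the four stubs.  (The HeavyThresholdYMBridge decl of the shared
item 8794, `Summit.QuantumFields.QCD.Theses.HeavyThresholdYMBridge.ThresholdQCD`, is definitionally the same `Prop`:
`example : HeavyThresholdYMBridge.ThresholdQCD := ThresholdQCD_proof` elaborates with that route file imported; it is not
imported here to keep this workfile's import cone to ONE foreign route file, FourMirrorsWardE1, needed for the E1 item.)

## Negative knowledge honoured
* `ledger crux ls stmt-QuantumFields-9737`: no `Disproof.lean`; no `_false_without_` theorems; the
  dead line `Lines/Sketch-dead.md` concerns the twisted-trace transfer of the WHOLE bridge, not the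
  threshold piece; `ledger crux ls stmt-QuantumFields-8794`: no workfiles (2026-08-17).
* `ledger negatives --problem QuantumFields`: none of the refuted statements (RobustYangMillsRG rev 2
  14958 — a HYPOTHESIS-side format decl, not used here; DiagonalMirrorRP 9665; AdaptiveCoarseSystem 9494;
  MultibosonLatticeGap 9599; AdmissibleRootsExist 9603) is a lattice package / OS closure / E1 module;
  no stub uses diagonal mirrors — rotations are a separate by-name stub, never derived from mirrors.
* The refuted D1-level `ConstructiveDecoupling := RobustYangMills → ThresholdQCD` (stmt-14372): nothing
  here is stated at the fine D1 level or conditionally on a format class.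

## BC3 probes (registrar folder `bc/`)
For each of the four stub statements `X`: `example : X → ThresholdQCD`, `example : X → _root_.QCD`
(and `X → StableActionBridge`) by `first | exact? | simpa [X] | (unfold X; simpa) | aesop`
(`maxHeartbeats 400000`) — all FAIL; outputs in the registrar's NOTES.md and `Lines/stub_thresholdQCD.md`.
-/

noncomputable section

namespace Summit.QuantumFields.QCD.Cruxes.StableActionBridge.StubThresholdQCD

open scoped BigOperators Topology Classical SchwartzMap
open MeasureTheory Filter
open Literature.MathematicalPhysics.AQFT Literature.MathematicalPhysics.QuantumLattice
  Literature.MathematicalPhysics.QuantumFieldTheory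
open Summit.QuantumFields.QCD.Theses.QuarksAsStableAction (ThresholdQCD StableActionBridge)
open Summit.QuantumFields.QCD.Theses.FourMirrorsWardE1 (RotationRestoration)

local notation "𝔼" => EuclideanSpace ℝ (Fin 4)

/-! ## §0 Currency (verbatim the sibling skeletons' §0) -/

/-- **Convergence on off-diagonal real tensors, ∃-limit form**: every lattice `n`-point function
(`n ≥ 1`) of the scheme converges along the full sequence whenever the real test functions admit an
off-diagonal tensor. -/
def ConvergesOffDiag {Nf : ℕ} (sch : QCDScheme Nf) : Prop :=
  ∀ n : ℕ, n ≠ 0 → ∀ (σ : Fin n → QCDField Nf) (f : Fin n → 𝓢(𝔼, ℝ)) (F : 𝓢((Fin n → 𝔼), ℂ)),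
    IsTensorOf F (fun i => ofRealTest (f i)) → IsOffDiagonal F →
      ∃ c : ℂ, Tendsto (fun k : ℕ => qcdLatticeSchwinger sch k n σ f) atTop (𝓝 c)

/-- **`S` IS the limit on off-diagonal real tensors** (literally the third clause of `IsQCDAlong sch T`
with `S` for `T.schwinger`). -/
def IsLatticeLimit {Nf : ℕ} (sch : QCDScheme Nf) (S : LabelledSchwingerFamily (QCDField Nf) 𝔼) : Prop :=
  ∀ n : ℕ, n ≠ 0 → ∀ (σ : Fin n → QCDField Nf) (f : Fin n → 𝓢(𝔼, ℝ)) (F : 𝓢((Fin n → 𝔼), ℂ)),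
    IsTensorOf F (fun i => ofRealTest (f i)) → IsOffDiagonal F →
      Tendsto (fun k : ℕ => qcdLatticeSchwinger sch k n σ f) atTop (𝓝 (S n σ F))

/-- A lattice limit converges (the ∃-limit currency from the `S`-currency). [folklore] -/
theorem IsLatticeLimit.convergesOffDiag {Nf : ℕ} {sch : QCDScheme Nf}
    {S : LabelledSchwingerFamily (QCDField Nf) 𝔼} (h : IsLatticeLimit sch S) : ConvergesOffDiag sch :=
  fun n hn σ f F hF hoff => ⟨S n σ F, h n hn σ f F hF hoff⟩

/-- **Species `s` is not a c-number, at the level of the labelled family `S`** (the body of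
`OSData.IsNontrivial` with `S` for `T.schwinger`, so that it IS `(OSData.ofAxioms S h).IsNontrivial s`
definitionally). -/
def SpeciesNontrivial {ι : Type} (S : LabelledSchwingerFamily ι 𝔼) (s : ι) : Prop :=
  ∃ (F G : 𝓢((Fin 1 → 𝔼), ℂ)) (H : 𝓢((Fin (1 + 1) → 𝔼), ℂ)),
    IsTimeOrdered F ∧ IsTimeOrdered G ∧ IsAppendTensorOf H (osAdjoint F) G ∧
      S (1 + 1) (fun _ => s) H ≠ S 1 (fun _ => s) (osAdjoint F) * S 1 (fun _ => s) G

/-- **Species `s` is not a generalised free field, at the level of `S`** (the body of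
`OSData.IsNonGaussian` with `S` for `T.schwinger`). -/
def SpeciesNonGaussian {ι : Type} (S : LabelledSchwingerFamily ι 𝔼) (s : ι) : Prop :=
  ∃ (f g h : 𝓢(𝔼, ℂ)) (Ffgh : 𝓢((Fin 3 → 𝔼), ℂ)) (Fgh Ffh Ffg : 𝓢((Fin 2 → 𝔼), ℂ))
    (Ff Fg Fh : 𝓢((Fin 1 → 𝔼), ℂ)),
    IsTensorOf Ffgh ![f, g, h] ∧ IsOffDiagonal Ffgh ∧
    IsTensorOf Fgh ![g, h] ∧ IsTensorOf Ffh ![f, h] ∧ IsTensorOf Ffg ![f, g] ∧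
    IsTensorOf Ff ![f] ∧ IsTensorOf Fg ![g] ∧ IsTensorOf Fh ![h] ∧
      S 3 (fun _ => s) Ffgh - S 1 (fun _ => s) Ff * S 2 (fun _ => s) Fgh -
          S 1 (fun _ => s) Fg * S 2 (fun _ => s) Ffh - S 1 (fun _ => s) Fh * S 2 (fun _ => s) Ffg +
        2 * (S 1 (fun _ => s) Ff * S 1 (fun _ => s) Fg * S 1 (fun _ => s) Fh) ≠ 0

/-! ## §1 The stub statements -/

/-- **(T1) Heavy-quark lattice QCD and its package — UV + IR existence above a threshold, THE hard
stub.**  For `N_f = 2` and `N_f = 3`: a threshold `M₀ ≥ 0` and one mass-independent regularisation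
`reg` with leading-log `HasMassScaling` such that for every mass tuple `m` with all `m_f > M₀` there
are species renormalisations `z, shift` and a labelled Schwinger family `S` which is normalised (E0),
of linear growth (E0'), symmetric (E3) and translation invariant on `⁰𝒮`, IS the `k → ∞` limit of the
honest lattice QCD `n`-point functions along `reg.scheme m z shift` on off-diagonal real tensors
(two-loop asymptotic scaling, bare Wilson masses eventually on the physical branch), comes with a
uniform lattice mass gap `Δ > 0` at the same couplings, and has non-trivial and non-Gaussian `glue`
and non-trivial flavour-changing pseudoscalars `pseudoRe f g` (`f ≠ g`) at the level of `S`.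
Open-problem: UV stability of 4D `SU(3)` with dynamical (heavy) Wilson quarks, the volume-uniform
lattice gap of the heavy-quark theory through the crossover, non-decoupling; NO chiral clause. -/
def HeavyLatticePackageStmt : Prop :=
  ∀ Nf : ℕ, (Nf = 2 ∨ Nf = 3) → ∃ M₀ : ℝ, 0 ≤ M₀ ∧ ∃ reg : QCDRegularisation Nf, reg.HasMassScaling ∧
    ∀ m : Fin Nf → ℝ, (∀ f, M₀ < m f) →
      ∃ (z shift : QCDField Nf → ℕ → ℝ) (S : LabelledSchwingerFamily (QCDField Nf) 𝔼),
        S.IsNormalized ∧ S.HasLinearGrowth ∧ S.IsSymmetric ∧ S.IsTranslationInvariant ∧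
        (reg.scheme m z shift).HasAsymptoticScaling ∧
        (∀ fl : Fin Nf, ∀ᶠ k in atTop, -1 < (reg.scheme m z shift).mq fl k) ∧
        IsLatticeLimit (reg.scheme m z shift) S ∧
        (∃ Δ > 0, (reg.scheme m z shift).HasLatticeMassGap Δ) ∧
        SpeciesNontrivial S QCDField.glue ∧ SpeciesNonGaussian S QCDField.glue ∧
        ∀ f g : Fin Nf, f ≠ g → SpeciesNontrivial S (QCDField.pseudoRe f g)

/-- **(T2) E0-hermiticity, E2 and E4 of the limit — IR-soft** (VERBATIM the sibling skeletons'
`ReflectionAxiomsStmt`).  For every two-loop-AF lattice-QCD scheme with bare masses eventually on the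
physical branch and a uniform lattice gap, every normalised, linear-growth, translation-invariant
labelled family that is the limit of its `n`-point functions on off-diagonal real tensors is hermitian,
reflection positive and has the cluster property.  Open (`S → ∞` before `k → ∞` for the time-periodic
own-torus functional). -/
def ReflectionAxiomsStmt : Prop :=
  ∀ (Nf : ℕ) (sch : QCDScheme Nf), sch.HasAsymptoticScaling →
    (∀ fl : Fin Nf, ∀ᶠ k in atTop, -1 < sch.mq fl k) → (∃ Δ > 0, sch.HasLatticeMassGap Δ) →
    ∀ S : LabelledSchwingerFamily (QCDField Nf) 𝔼, S.IsNormalized → S.HasLinearGrowth →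
      S.IsTranslationInvariant → IsLatticeLimit sch S →
        S.IsHermitian ∧ S.IsReflectionPositive ∧ S.HasClusterProperty

/-- **(T3) The lattice gap in OS currency — IR-hard, lattice side** (VERBATIM the sibling skeletons'
`SpeciesDiagClusteringStmt`).  Along a two-loop-AF scheme with bare masses eventually on the physical
branch whose species `n`-point functions converge on off-diagonal real tensors, the uniform lattice gap
`HasLatticeMassGap Δ` (`0 < Δ`) gives diagonal clustering AT THE SAME RATE `Δ` of the smeared
renormalised species fields on the scheme's own tori, `sch.HasSpeciesDiagClustering Δ`.  Open
(pair-dependent thresholds; thermal wrap-around). -/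
def SpeciesDiagClusteringStmt : Prop :=
  ∀ (Nf : ℕ) (sch : QCDScheme Nf) (Δ : ℝ), 0 < Δ → sch.HasAsymptoticScaling →
    (∀ fl : Fin Nf, ∀ᶠ k in atTop, -1 < sch.mq fl k) → sch.HasLatticeMassGap Δ →
    ConvergesOffDiag sch → sch.HasSpeciesDiagClustering Δ

/-! ## §2 The registered stubs (the ONLY `sorry`s of this file) -/

/-- (T1) heavy-quark lattice QCD and its package — THE hard stub, open-problem. -/
theorem stub_heavyLatticePackage : HeavyLatticePackageStmt := by
  sorry

/-- (T2) E0-hermiticity, E2, E4 of the limit — open, size L. -/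
theorem stub_reflectionAxioms : ReflectionAxiomsStmt := by
  sorry

/-- (T3) the lattice gap in OS currency (species diagonal clustering at the lattice rate) — open, size L/XL. -/
theorem stub_speciesDiagClustering : SpeciesDiagClusteringStmt := by
  sorry

/-- (T4) the E1 module — item stmt-QuantumFields-8840 `FourMirrorsWardE1.RotationRestoration` BY NAME, open-problem. -/
theorem stub_rotationRestoration : RotationRestoration := by
  sorry

/-! ### Name-keyed aliases of the four statements (hypotheses of the composition)

`Registered.stub_X` is statement `X` under the registered stub's short name, so that the native skeleton
audit (hypotheses admissible iff registered obligations / declared stubs BY NAME) accepts `ThresholdQCD_of`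
whichever candidate it inspects (device of `Cruxes/RotationRestoration/Lines/birth.lean`). -/
namespace Registered

/-- Alias of `HeavyLatticePackageStmt` keyed by the registered stub name. -/
abbrev stub_heavyLatticePackage : Prop := HeavyLatticePackageStmt
/-- Alias of `ReflectionAxiomsStmt` keyed by the registered stub name. -/
abbrev stub_reflectionAxioms : Prop := ReflectionAxiomsStmt
/-- Alias of `SpeciesDiagClusteringStmt` keyed by the registered stub name. -/
abbrev stub_speciesDiagClustering : Prop := SpeciesDiagClusteringStmt
/-- Alias of the item `RotationRestoration` keyed by the registered stub name. -/
abbrev stub_rotationRestoration : Prop := RotationRestoration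

end Registered

/-! ## §3 Composition (kernel-checked; no `sorry` below this line) -/

/-- **The piece from the four stubs** (concludes `QuarksAsStableAction.ThresholdQCD` BY NAME).  For
`N_f ∈ {2, 3}` the package stub gives the threshold `M₀ ≥ 0`, the regularisation `reg` (mass scaling)
and, per mass tuple above `M₀`, `z, shift, S` with E0, E0', E3, translations, the convergence-to-`S`
clause, asymptotic scaling, the physical branch and the lattice gap `Δ > 0`; the IR-soft stub gives
E0-hermiticity, E2, E4; the E1 module gives proper rotations for THIS scheme and THIS limit; the OS
package `T := OSData.ofAxioms S _` has `T.schwinger = S` definitionally, so `IsQCDAlong` holds clause by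
clause and the species clauses are the `S`-level ones; the lattice gap `Δ` ⇒ species diagonal
clustering at `Δ` (IR-hard stub) ⇒ `T.HasMassGap Δ` by the landed
`IsQCDAlong.hasMassGap_of_hasSpeciesDiagClustering` — the SAME `Δ`. [folklore] -/
theorem ThresholdQCD_of (hPk : Registered.stub_heavyLatticePackage)
    (hIR : Registered.stub_reflectionAxioms) (hLat : Registered.stub_speciesDiagClustering)
    (hRot : Registered.stub_rotationRestoration) : ThresholdQCD := by
  intro Nf hNf
  obtain ⟨M₀, hM₀, reg, hScal, hAll⟩ := hPk Nf hNf
  refine ⟨M₀, hM₀, reg, hScal, fun m hm => ?_⟩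
  obtain ⟨z, shift, S, hN, hLG, hSy, hTr, hAS, hbr, hLim, ⟨Δ, hΔ, hGapL⟩, hNT, hNG, hND⟩ := hAll m hm
  -- (T2) IR-soft: hermiticity, reflection positivity, cluster property of the limit
  obtain ⟨hH, hRP, hCl⟩ :=
    hIR Nf (reg.scheme m z shift) hAS hbr ⟨Δ, hΔ, hGapL⟩ S hN hLG hTr hLim
  -- (T4) the E1 module: proper rotations for this scheme and this limit
  have hE1 := hRot Nf (reg.scheme m z shift) hAS hbr ⟨Δ, hΔ, hGapL⟩ S
    (fun n hn σ f F hF hoff => hLim n hn σ f F hF hoff)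
  -- the OS package, Schwinger functions `S` by `rfl`
  have hOS : OSAxiomsSchwinger S :=
    { normalized := hN
      hermitian := hH
      invariant := ⟨hTr, hE1⟩
      reflectionPositive := hRP
      symmetric := hSy
      cluster := hCl
      linearGrowth := hLG }
  have hQCD : IsQCDAlong (reg.scheme m z shift) (OSData.ofAxioms S hOS) := ⟨hAS, hbr, hLim⟩
  -- (T3) + landed transfer: the continuum gap at the lattice rate `Δ`
  have hDiag : (reg.scheme m z shift).HasSpeciesDiagClustering Δ :=
    hLat Nf (reg.scheme m z shift) Δ hΔ hAS hbr hGapL hLim.convergesOffDiag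
  have hGapT : (OSData.ofAxioms S hOS).HasMassGap Δ :=
    hQCD.hasMassGap_of_hasSpeciesDiagClustering hDiag
  exact ⟨z, shift, OSData.ofAxioms S hOS, hQCD, hNT, hNG, hND, Δ, hΔ, hGapT, hGapL⟩

/-- **The skeleton** (the hypothesis-free `<Piece>_proof` the skeleton check reads; its `sorry`-cone is
exactly the four registered stubs): the piece `stub_thresholdQCD : ThresholdQCD` along this line. -/
theorem ThresholdQCD_proof : ThresholdQCD :=
  ThresholdQCD_of stub_heavyLatticePackage stub_reflectionAxioms stub_speciesDiagClustering
    stub_rotationRestoration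

end Summit.QuantumFields.QCD.Cruxes.StableActionBridge.StubThresholdQCD

end
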